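import Summits.RiemannHypothesis.RiemannHypothesis.Theorems.HandoffRouteEAssembly

/-!
# Handoff (rh-explicit, prove-1), Route E: WEIL SILENCE of leak-controlled tests (RH-free)

The bilinear Weil form `B(k, v) := W(k ⋆ ṽ)` of a test `k` whose transform is small AT the
non-trivial zeros — wherever they are — against an ARBITRARY test `v` is small:

  `‖W(k ⋆ ṽ)‖ ≤ A · D_v · Σ_ρ m(ρ)/(1+γ²)²`   whenever `‖k̂(ρ)‖ ≤ A/(1+γ²)` at every non-trivial zero,

with `D_v = weilDecayConst v` (strip decay of `v̂`, two integrations by parts).  Proof: the explicit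
formula `W(F) = lim_T Σ_{|Im ρ| ≤ T} m(ρ) F̂(ρ)` (`explicit_formula_holds`, no RH) for `F = k ⋆ ṽ`,
`F̂(ρ) = k̂(ρ) · conj v̂(1 - ρ̄)`, `‖v̂(1 - ρ̄)‖ ≤ D_v/(1+γ²)` in the strip, and zero counting
(`weilZeroSummable`).  For the Route E tests `k = (g_λ ⋆ φ_j)` (`g_λ = winTestW h λ θ` the windowed
E-map image of a seed with summable Fourier envelope `A_seed`, `φ_j` the mollifier) this gives
`‖W(k ⋆ ṽ)‖ ≤ (3A_seed/λ²) · D_{φ_j} · D_v · W` for EVERY test `v`: the explicit near-null vectors of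
THEOREM E♭ are approximate annihilators of the Weil form («Weil silence», handoff/prove-1
ATTEMPT-2/SILENCE-LAW as DATA with C ∈ [0.77, 4.72]; here a THEOREM for the explicit vectors, with
the leak constant in place of √ε).  No hypothesis on the zeros; nothing here bears on RH.
-/

set_option linter.dupNamespace false  -- the mandated namespace repeats `RiemannHypothesis`

noncomputable section

open Complex Filter Set Topology MeasureTheory
open scoped FourierTransform ComplexConjugate
open Literature.NumberTheory.LFunctions Literature.NumberTheory.LFunctions.WeilContinuous

namespace Summit.RiemannHypothesis.RiemannHypothesis.Theorems.HandoffRouteE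

open Summit.RiemannHypothesis.RiemannHypothesis.Theorems

/-- A zero indexed by the Weil zero side is a non-trivial zero. -/
theorem mem_nontrivialZeros_of_mem_weilZeroIndex {T : ℝ} {ρ : ℂ} (h : ρ ∈ weilZeroIndex T) :
    ρ ∈ ZetaZeros.riemannZetaNontrivialZeros := by
  obtain ⟨h0, h1⟩ := re_pos_and_lt_one_of_mem_weilZeroIndex h
  exact mem_riemannZetaNontrivialZeros_iff_holds.2 ⟨h.1, h0, h1⟩

/-- Strip decay of the reflected test at a non-trivial zero: `‖(ṽ)^(ρ)‖ ≤ D_v/(1+γ²)`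
[Bombieri 2000 §2: `(ṽ)^(s) = conj v̂(1 - s̄)`; two integrations by parts]. -/
theorem norm_weilMellin_weilReflect_le {v : ℝ → ℂ} (hv : IsWeilTest v) {ρ : ℂ}
    (hρ : ρ ∈ ZetaZeros.riemannZetaNontrivialZeros) :
    ‖weilMellin (weilReflect v) ρ‖ ≤ weilDecayConst v / (1 + ρ.im ^ 2) := by
  obtain ⟨-, h0, h1⟩ := mem_riemannZetaNontrivialZeros_iff_holds.1 hρ
  rw [weilMellin_weilReflect_holds v ρ, Complex.norm_conj]
  have hre : (1 - conj ρ).re = 1 - ρ.re := by simp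
  have him : (1 - conj ρ).im = ρ.im := by simp
  have h := norm_weilMellin_le hv (s := 1 - conj ρ) (by rw [hre]; linarith) (by rw [hre]; linarith)
  rwa [him] at h

/-- **WEIL SILENCE (RH-free)** [explicit formula `explicit_formula_holds` + Bessel-free termwise
bound + zero counting `weilZeroSummable`; cite: Bombieri2000Weil, Thm 2]: if the transform of a test
`k` satisfies `‖k̂(ρ)‖ ≤ A/(1+γ²)` at every non-trivial zero, then for EVERY test `v`
`‖W(k ⋆ ṽ)‖ ≤ A · D_v · Σ'_ρ w(ρ)`, `w(ρ) = m(ρ)/(1+γ²)²`. -/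
theorem norm_weilFunctional_weilConv_weilReflect_le {k v : ℝ → ℂ} (hk : IsWeilTest k)
    (hv : IsWeilTest v) {A : ℝ} (hA : 0 ≤ A)
    (hkρ : ∀ ρ ∈ ZetaZeros.riemannZetaNontrivialZeros, ‖weilMellin k ρ‖ ≤ A / (1 + ρ.im ^ 2)) :
    ‖weilFunctional (weilConv k (weilReflect v))‖ ≤
      A * weilDecayConst v * ∑' ρ : ZetaZeros.riemannZetaNontrivialZeros, weilZeroWeight (ρ : ℂ) := by
  set W : ℝ := ∑' ρ : ZetaZeros.riemannZetaNontrivialZeros, weilZeroWeight (ρ : ℂ) with hW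
  have hvr : IsWeilTest (weilReflect v) := hv.weilReflect
  have hF : IsWeilTest (weilConv k (weilReflect v)) := hk.weilConv hvr
  have hDv : 0 ≤ weilDecayConst v := weilDecayConst_nonneg v
  -- the explicit formula for `F = k ⋆ ṽ`
  have hlim : Tendsto (fun T => ‖weilZeroSidePartial (weilConv k (weilReflect v)) T‖) atTop
      (𝓝 ‖weilFunctional (weilConv k (weilReflect v))‖) :=
    (continuous_norm.tendsto _).comp (explicit_formula_holds hF)
  refine le_of_tendsto' hlim fun T => ?_
  -- termwise bound on the truncation
  have hfin := weilZeroIndex_finite T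
  have hmem : ∀ ρ, ρ ∈ hfin.toFinset ↔ ρ ∈ weilZeroIndex T := fun ρ => hfin.mem_toFinset
  have hterm : ∀ ρ ∈ hfin.toFinset,
      ‖(riemannZetaZeroOrder ρ : ℂ) * weilMellin (weilConv k (weilReflect v)) ρ‖ ≤
        A * weilDecayConst v * weilZeroWeight ρ := by
    intro ρ hρ
    have hρi := (hmem ρ).1 hρ
    have hρn := mem_nontrivialZeros_of_mem_weilZeroIndex hρi
    have hne : ρ ≠ 1 := ZetaZeros.riemannZetaNontrivialZeros.ne_one hρn
    have hm0 : (0 : ℝ) ≤ riemannZetaZeroOrder ρ := by exact_mod_cast riemannZetaZeroOrder_nonneg hne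
    have hpos : 0 < 1 + ρ.im ^ 2 := by positivity
    rw [norm_mul, Complex.norm_intCast, abs_of_nonneg hm0,
      weilMellin_weilConv_holds hk.1.continuous hk.2 hvr.1.continuous hvr.2 ρ, norm_mul]
    have h1 := hkρ ρ hρn
    have h2 := norm_weilMellin_weilReflect_le hv hρn
    calc (riemannZetaZeroOrder ρ : ℝ) * (‖weilMellin k ρ‖ * ‖weilMellin (weilReflect v) ρ‖)
        ≤ (riemannZetaZeroOrder ρ : ℝ) * (A / (1 + ρ.im ^ 2) * (weilDecayConst v / (1 + ρ.im ^ 2))) :=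
          mul_le_mul_of_nonneg_left (mul_le_mul h1 h2 (norm_nonneg _) (div_nonneg hA hpos.le)) hm0
      _ = A * weilDecayConst v * weilZeroWeight ρ := by
          rw [weilZeroWeight]
          field_simp
  -- sum over the truncation and compare with the full (convergent) zero sum
  have hsum : ∑ ρ ∈ hfin.toFinset, A * weilDecayConst v * weilZeroWeight ρ ≤ A * weilDecayConst v * W := by
    rw [← finsum_mem_eq_finite_toFinset_sum (fun ρ => A * weilDecayConst v * weilZeroWeight ρ) hfin,
      finsum_weilZeroIndex_eq_sum (fun ρ => A * weilDecayConst v * weilZeroWeight ρ) T, hW,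
      ← tsum_mul_left]
    exact (weilZeroSummable.mul_left (A * weilDecayConst v)).sum_le_tsum _
      fun ρ _ => mul_nonneg (mul_nonneg hA hDv) (weilZeroWeight_nonneg ρ.2)
  unfold weilZeroSidePartial
  rw [finsum_mem_eq_finite_toFinset_sum _ hfin]
  exact (norm_sum_le _ _).trans ((Finset.sum_le_sum hterm).trans hsum)

/-- **Silence of a mollified test that is small at the zeros**: if `‖ĝ(ρ)‖ ≤ G₀` at every
non-trivial zero (`g` continuous, compactly supported), then for the test `k = g ⋆ φ_j` and every
test `v`: `‖W(k ⋆ ṽ)‖ ≤ G₀ · D_{φ_j} · D_v · W`. -/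
theorem norm_weilFunctional_moll_le {g v : ℝ → ℂ} (hgc : Continuous g) (hgs : HasCompactSupport g)
    (hv : IsWeilTest v) {G₀ : ℝ} (hG : 0 ≤ G₀)
    (hgρ : ∀ ρ ∈ ZetaZeros.riemannZetaNontrivialZeros, ‖weilMellin g ρ‖ ≤ G₀) (j : ℕ) :
    ‖weilFunctional (weilConv (weilConv g (moll j)) (weilReflect v))‖ ≤
      G₀ * weilDecayConst (moll j) * weilDecayConst v *
        ∑' ρ : ZetaZeros.riemannZetaNontrivialZeros, weilZeroWeight (ρ : ℂ) := by
  have hk : IsWeilTest (weilConv g (moll j)) := isWeilTest_weilConv_moll hgc hgs j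
  have hD : 0 ≤ weilDecayConst (moll j) := weilDecayConst_nonneg _
  refine norm_weilFunctional_weilConv_weilReflect_le hk hv (mul_nonneg hG hD) fun ρ hρ => ?_
  obtain ⟨-, h0, h1⟩ := mem_riemannZetaNontrivialZeros_iff_holds.1 hρ
  have hpos : 0 < 1 + ρ.im ^ 2 := by positivity
  rw [weilMellin_weilConv_moll hgc hgs j ρ, norm_mul, mul_div_assoc]
  exact mul_le_mul (hgρ ρ hρ) (norm_weilMellin_le (isWeilTest_moll j) h0.le h1.le) (norm_nonneg _) hG

/-- **WEIL SILENCE OF THE ROUTE E TESTS (RH-free)**: for an even Schwartz seed `h` with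
`h(0) = 0 = ∫ h`, `h = 0` on `(1, ∞)`, and the summable Fourier envelope `‖𝓕h(ξ)‖ ≤ A ξ⁻²`
(`ξ ≥ λ²`, `λ ≥ 2`), the explicit near-null test `k = winTestW h λ θ ⋆ φ_j` of THEOREM E♭ satisfies,
for EVERY test `v`, `‖W(k ⋆ ṽ)‖ ≤ (3A/λ²) · D_{φ_j} · D_v · W`: it is an approximate annihilator of the
bilinear Weil form, with the leak constant `3A/λ²` (`≍ poly(λ) e^{-2πλ²}` for the concentrated
seeds of handoff/prove-1 ATTEMPT-10/12) [cite: Bombieri2000Weil, Thm 2]. -/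
theorem weil_silence_winTestW (h : SchwartzMap ℝ ℂ) (heven : ∀ x, h (-x) = h x) (h0 : h 0 = 0)
    (hint : ∫ x : ℝ, h x = 0) (hsupp : ∀ x : ℝ, 1 < x → h x = 0) {lam : ℝ} (hlam : 2 ≤ lam)
    {A : ℝ} (hA : 0 ≤ A) (hF : ∀ ξ : ℝ, lam ^ 2 ≤ ξ → ‖(𝓕 h : SchwartzMap ℝ ℂ) ξ‖ ≤ A * (ξ ^ 2)⁻¹)
    {θ : ℝ} (hθ0 : 0 < θ) (hθ1 : θ < 1) (j : ℕ) {v : ℝ → ℂ} (hv : IsWeilTest v) :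
    ‖weilFunctional (weilConv (weilConv (winTestW h lam θ) (moll j)) (weilReflect v))‖ ≤
      3 * A / lam ^ 2 * weilDecayConst (moll j) * weilDecayConst v *
        ∑' ρ : ZetaZeros.riemannZetaNontrivialZeros, weilZeroWeight (ρ : ℂ) := by
  have hlam1 : 1 ≤ lam := by linarith
  have hlam0 : 0 < lam := by linarith
  -- the E-map leak bound on `(0, 1/λ]` from the summable envelope (Solo XII-quant, `X = λ²`)
  have hE : ∀ u : ℝ, 0 < u → u ≤ lam⁻¹ → ‖eMapFn h lam u‖ ≤ 3 * A * (lam⁻¹ * u) := by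
    intro u hu hul
    have hX : 0 < lam ^ 2 := by positivity
    have hux : lam ^ 2 * u ≤ lam := by
      calc lam ^ 2 * u ≤ lam ^ 2 * lam⁻¹ := by gcongr
        _ = lam := by field_simp
    exact norm_eMapFn_le_of_fourier_decay h heven h0 hint hA hX hF hlam0 hu hux
  have hG : 0 ≤ 3 * A / lam ^ 2 := by positivity
  refine norm_weilFunctional_moll_le (continuous_winTestW h hlam0 θ)
    (hasCompactSupport_winTestW h hsupp hlam1 hθ0 hθ1) hv hG (fun ρ hρ => ?_) j
  exact norm_weilMellin_winTestW_le_of_bound h heven h0 hint hsupp (by positivity) hlam1 hθ1 hE hρ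

end Summit.RiemannHypothesis.RiemannHypothesis.Theorems.HandoffRouteE
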